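import Summits.ValiantsHypothesis.ValiantsHypothesis.Theorems.KPlusLogSqLawTropicalBToeplitzWindow

/-!
# Route `KPlusLogSqLaw`, crux `TropicalB` — Toeplitz sector: TRANSLATED windows of unique optima (hereditary structure of Conjecture T)

HONEST FRAMING.  Helper toward the registered stubs `stub_tropThin` / `stub_tropFat` of
`Cruxes/TropicalB/Lines/birth.lean` (crux `Summit.ValiantsHypothesis.ValiantsHypothesis.Theses.KPlusLogSqLaw.TropicalB`,
ledger item `stmt-ValiantsHypothesis-19771`, route `KPlusLogSqLaw`; cell `pub-symmetroid`, seat `val-sym-trop-p3`,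
2026-08-26).  Generalises `…ToeplitzWindow` (invariant windows) to TRANSLATED windows.  Nothing here bounds `Φ`,
`TropicalB`, `KPlusLogSqLaw`, `MatrixDescartes` or anything about `VP ≠ VNP`.

THE DATUM (seat scripts on the kernel-certified extremal chains `…ToeplitzSix…Ten`, located): with INVARIANT windows about
half of the chain members are frameless, but EVERY member of every certified chain (m = 6, …, 10) maps some window
`[a, a + ℓ)` with `ℓ ≥ 2` onto a translate `[a', a' + ℓ)` — mostly with `ℓ ∈ {m − 1, m − 2}` — and the chains use
6–13 distinct largest such frames.  Extremal optima are HEREDITARY: a small frame around an optimum of a shifted instance.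

THE RESULTS.
* `toeplitz_opt_translatedWindow` — if the unique maximiser `τ` maps `[a, a + ℓ)` into `[a', a' + ℓ)`, its window pattern
  `j ↦ τ(a + j) − a'` is a permutation of `Fin ℓ` and is the UNIQUE maximiser of the SHIFTED instance
  `(ψ(· + t), α(· + t))`, `t = a' − a`, among permutations admissible for `P(· + t)` (implant a competitor; the
  complement of the window goes to the complement of the translate, `perm_not_mem_of_mapsTo_card`).
* `toeplitz_translatedWindow_chain_le` — members of a chain sharing a translated frame (same window, same translate,
  same values outside) number at most any chain bound of the shifted instance at size `ℓ`.
READING.  Since `Φ_Toep(ℓ) = sup` over ALL instances (shifts included), each translated frame of window size `ℓ` carries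
`≤ Φ_Toep(ℓ)` members; Conjecture T's open content is the number of frames a chain uses (data: 6–13 at m = 6–10).

References: folklore; `toeplitz_opt_window`, `sum_finWindow_eq` (`…ToeplitzWindow`).
-/

set_option linter.dupNamespace false
set_option autoImplicit false

namespace Summit.ValiantsHypothesis.ValiantsHypothesis.Theorems.KPlusLogSqLaw

open scoped BigOperators
open Finset

section TranslatedWindow

variable {m : ℕ}

/-- A permutation mapping a finite set `S` into a set `T` of the same cardinality maps the complement of `S` into the
complement of `T`. [folklore] -/
theorem perm_not_mem_of_mapsTo_card (τ : Equiv.Perm (Fin m)) (S T : Finset (Fin m)) (hS : ∀ b ∈ S, τ b ∈ T)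
    (hcard : T.card ≤ S.card) (b : Fin m) (hb : b ∉ S) : τ b ∉ T := by
  intro h
  have himg : S.image τ = T := by
    apply eq_of_subset_of_card_le
    · intro y hy
      obtain ⟨x, hx, rfl⟩ := mem_image.mp hy
      exact hS x hx
    · rw [card_image_of_injective S τ.injective]; exact hcard
  rw [← himg] at h
  obtain ⟨x, hx, hxe⟩ := mem_image.mp h
  exact hb (τ.injective hxe ▸ hx)

/-- … and its inverse maps `T` into `S`. [folklore] -/
theorem perm_symm_mem_of_mapsTo_card (τ : Equiv.Perm (Fin m)) (S T : Finset (Fin m)) (hS : ∀ b ∈ S, τ b ∈ T)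
    (hcard : T.card ≤ S.card) (y : Fin m) (hy : y ∈ T) : τ.symm y ∈ S := by
  by_contra h
  have := perm_not_mem_of_mapsTo_card τ S T hS hcard (τ.symm y) h
  rw [Equiv.apply_symm_apply] at this
  exact this hy

/-- cardinality of a window of `Fin m`. [folklore] -/
theorem card_finWindow (a ℓ : ℕ) (h : a + ℓ ≤ m) :
    (univ.filter fun x : Fin m => a ≤ (x : ℕ) ∧ (x : ℕ) < a + ℓ).card = ℓ := by
  have := sum_finWindow_eq (m := m) a ℓ h (fun _ => (1 : ℤ))
  simp only [sum_const, nsmul_eq_mul, mul_one, card_univ, Fintype.card_fin] at this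
  exact_mod_cast this

/-- **Translated windows of unique optima are unique optima of the SHIFTED instance.**  Let `τ` be the unique maximiser of
`W_θ` among admissible permutations of `Fin m`, and suppose `τ` maps the window `[a, a + ℓ)` into the translated window
`[a', a' + ℓ)`.  Then the window pattern `τw j = τ (a + j) − a'` is a permutation of `Fin ℓ` and it is the UNIQUE maximiser,
among permutations admissible for the shifted admissible set `P (· + t)`, of the SHIFTED instance `(ψ (· + t), α (· + t))` of
size `ℓ`, `t = a' − a` (implant a competitor; Toeplitz costs are translation-invariant).  `toeplitz_opt_window` is `t = 0`.
In the cell's certified extremal chains (`…ToeplitzSix…Ten`) EVERY member has such a translated window of length `≥ 2`, most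
of length `m − 1` or `m − 2`: extremal optima are hereditary. [folklore] -/
theorem toeplitz_opt_translatedWindow (ψ α : ℤ → ℤ) (P : ℤ → Prop) (θ : ℤ) (τ : Equiv.Perm (Fin m)) (a a' ℓ : ℕ)
    (h : a + ℓ ≤ m) (h' : a' + ℓ ≤ m)
    (hinv : ∀ b : Fin m, a ≤ (b : ℕ) → (b : ℕ) < a + ℓ → a' ≤ ((τ b : Fin m) : ℕ) ∧ ((τ b : Fin m) : ℕ) < a' + ℓ)
    (hτP : ∀ b, P ((τ b : ℤ) - b))
    (huniq : ∀ σ : Equiv.Perm (Fin m), σ ≠ τ → (∀ b, P ((σ b : ℤ) - b)) →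
      ∑ b, (θ * ψ ((σ b : ℤ) - b) + α ((σ b : ℤ) - b)) < ∑ b, (θ * ψ ((τ b : ℤ) - b) + α ((τ b : ℤ) - b))) :
    ∃ τw : Equiv.Perm (Fin ℓ),
      (∀ (j : Fin ℓ) (b : Fin m), (b : ℕ) = a + j → ((τw j : Fin ℓ) : ℕ) + a' = ((τ b : Fin m) : ℕ)) ∧
      (∀ j, P (((τw j : ℤ) - j) + ((a' : ℤ) - a))) ∧
      ∀ σ' : Equiv.Perm (Fin ℓ), σ' ≠ τw → (∀ j, P (((σ' j : ℤ) - j) + ((a' : ℤ) - a))) →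
        ∑ j, (θ * ψ (((σ' j : ℤ) - j) + ((a' : ℤ) - a)) + α (((σ' j : ℤ) - j) + ((a' : ℤ) - a))) <
          ∑ j, (θ * ψ (((τw j : ℤ) - j) + ((a' : ℤ) - a)) + α (((τw j : ℤ) - j) + ((a' : ℤ) - a))) := by
  -- the window `S` and its translate `T`
  set S : Finset (Fin m) := univ.filter fun x : Fin m => a ≤ (x : ℕ) ∧ (x : ℕ) < a + ℓ with hSdef
  set T : Finset (Fin m) := univ.filter fun x : Fin m => a' ≤ (x : ℕ) ∧ (x : ℕ) < a' + ℓ with hTdef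
  have hST : ∀ b ∈ S, τ b ∈ T := by
    intro b hb
    simp only [hSdef, hTdef, mem_filter, mem_univ, true_and] at hb ⊢
    exact hinv b hb.1 hb.2
  have hcard : T.card ≤ S.card := by
    rw [hSdef, hTdef, card_finWindow a ℓ h, card_finWindow a' ℓ h']
  have hcomp : ∀ x : Fin m, ¬ (a ≤ (x : ℕ) ∧ (x : ℕ) < a + ℓ) →
      ¬ (a' ≤ ((τ x : Fin m) : ℕ) ∧ ((τ x : Fin m) : ℕ) < a' + ℓ) := by
    intro x hx
    have := perm_not_mem_of_mapsTo_card τ S T hST hcard x (by simpa [hSdef] using hx)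
    simpa [hTdef] using this
  have hsymm : ∀ y : Fin m, a' ≤ (y : ℕ) → (y : ℕ) < a' + ℓ →
      a ≤ ((τ.symm y : Fin m) : ℕ) ∧ ((τ.symm y : Fin m) : ℕ) < a + ℓ := by
    intro y hy1 hy2
    have := perm_symm_mem_of_mapsTo_card τ S T hST hcard y (by simp [hTdef]; exact ⟨hy1, hy2⟩)
    simpa [hSdef] using this
  -- the window permutation
  let f : Fin ℓ → Fin ℓ := fun j => ⟨((τ ⟨a + j, by omega⟩ : Fin m) : ℕ) - a', by
    have := hinv ⟨a + j, by omega⟩ (by simp) (by simp); omega⟩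
  let g : Fin ℓ → Fin ℓ := fun j => ⟨((τ.symm ⟨a' + j, by omega⟩ : Fin m) : ℕ) - a, by
    have := hsymm ⟨a' + j, by omega⟩ (by simp) (by simp); omega⟩
  have hgf : ∀ j, g (f j) = j := by
    intro j
    have h1 := hinv ⟨a + j, by omega⟩ (by simp) (by simp)
    apply Fin.ext
    simp only [f, g]
    have e1 : (⟨a' + (((τ ⟨a + j, by omega⟩ : Fin m) : ℕ) - a'), by omega⟩ : Fin m) = τ ⟨a + j, by omega⟩ :=
      Fin.ext (by simp; omega)
    rw [e1, Equiv.symm_apply_apply]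
    simp
  have hfg : ∀ j, f (g j) = j := by
    intro j
    have h1 := hsymm ⟨a' + j, by omega⟩ (by simp) (by simp)
    apply Fin.ext
    simp only [f, g]
    have e1 : (⟨a + (((τ.symm ⟨a' + j, by omega⟩ : Fin m) : ℕ) - a), by omega⟩ : Fin m) = τ.symm ⟨a' + j, by omega⟩ :=
      Fin.ext (by simp; omega)
    rw [e1, Equiv.apply_symm_apply]
    simp
  let τw : Equiv.Perm (Fin ℓ) := ⟨f, g, hgf, hfg⟩
  have hτw : ∀ (j : Fin ℓ) (b : Fin m), (b : ℕ) = a + j → ((τw j : Fin ℓ) : ℕ) + a' = ((τ b : Fin m) : ℕ) := by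
    intro j b hb
    have hb' : b = ⟨a + j, by omega⟩ := Fin.ext hb
    have h1 := hinv ⟨a + j, by omega⟩ (by simp) (by simp)
    show ((f j : Fin ℓ) : ℕ) + a' = _
    rw [hb']; simp only [f]; omega
  have hdisp : ∀ j : Fin ℓ, ((τw j : Fin ℓ) : ℤ) - j + ((a' : ℤ) - a) =
      ((τ ⟨a + j, by omega⟩ : Fin m) : ℤ) - (a + j : ℕ) := by
    intro j
    have := hτw j ⟨a + j, by omega⟩ rfl
    push_cast
    omega
  refine ⟨τw, hτw, fun j => ?_, fun σ' hne hσ'P => ?_⟩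
  · rw [hdisp]
    have := hτP ⟨a + j, by omega⟩
    push_cast at this ⊢
    exact this
  -- implant `σ'` into the window of `τ`, landing in the translated window
  let F : Fin m → Fin m := fun x =>
    if hx : a ≤ (x : ℕ) ∧ (x : ℕ) < a + ℓ then ⟨a' + σ' ⟨(x : ℕ) - a, by omega⟩, by
      have := (σ' ⟨(x : ℕ) - a, by omega⟩).isLt; omega⟩
    else τ x
  let G : Fin m → Fin m := fun y =>
    if hy : a' ≤ (y : ℕ) ∧ (y : ℕ) < a' + ℓ then ⟨a + σ'.symm ⟨(y : ℕ) - a', by omega⟩, by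
      have := (σ'.symm ⟨(y : ℕ) - a', by omega⟩).isLt; omega⟩
    else τ.symm y
  have hGF : ∀ x, G (F x) = x := by
    intro x
    by_cases hx : a ≤ (x : ℕ) ∧ (x : ℕ) < a + ℓ
    · have hFx : F x = ⟨a' + σ' ⟨(x : ℕ) - a, by omega⟩, by
          have := (σ' ⟨(x : ℕ) - a, by omega⟩).isLt; omega⟩ := dif_pos hx
      rw [hFx]
      simp only [G]
      rw [dif_pos (by simp)]
      apply Fin.ext
      simp only [Nat.add_sub_cancel_left, Fin.eta, Equiv.symm_apply_apply]
      omega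
    · have hFx : F x = τ x := dif_neg hx
      rw [hFx]
      simp only [G]
      rw [dif_neg (hcomp x hx), Equiv.symm_apply_apply]
  have hFG : ∀ y, F (G y) = y := by
    intro y
    by_cases hy : a' ≤ (y : ℕ) ∧ (y : ℕ) < a' + ℓ
    · have hGy : G y = ⟨a + σ'.symm ⟨(y : ℕ) - a', by omega⟩, by
          have := (σ'.symm ⟨(y : ℕ) - a', by omega⟩).isLt; omega⟩ := dif_pos hy
      rw [hGy]
      simp only [F]
      rw [dif_pos (by simp)]
      apply Fin.ext
      simp only [Nat.add_sub_cancel_left, Fin.eta, Equiv.apply_symm_apply]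
      omega
    · have hGy : G y = τ.symm y := dif_neg hy
      rw [hGy]
      simp only [F]
      have : ¬ (a ≤ ((τ.symm y : Fin m) : ℕ) ∧ ((τ.symm y : Fin m) : ℕ) < a + ℓ) := by
        intro h''
        have := hinv (τ.symm y) h''.1 h''.2
        rw [Equiv.apply_symm_apply] at this
        exact hy this
      rw [dif_neg this, Equiv.apply_symm_apply]
  let σ : Equiv.Perm (Fin m) := ⟨F, G, hGF, hFG⟩
  have hσ_in : ∀ j : Fin ℓ, ((σ ⟨a + j, by omega⟩ : Fin m) : ℤ) - (a + j : ℕ) =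
      ((σ' j : Fin ℓ) : ℤ) - j + ((a' : ℤ) - a) := by
    intro j
    show ((F ⟨a + j, by omega⟩ : Fin m) : ℤ) - (a + j : ℕ) = _
    simp only [F]
    rw [dif_pos (by simp)]
    simp only [Nat.add_sub_cancel_left, Fin.eta]
    push_cast
    ring
  have hσ_out : ∀ x : Fin m, ¬ (a ≤ (x : ℕ) ∧ (x : ℕ) < a + ℓ) → σ x = τ x := by
    intro x hx
    show F x = τ x
    exact dif_neg hx
  have hστ : σ ≠ τ := by
    intro hEq
    apply hne
    apply Equiv.ext
    intro j
    apply Fin.ext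
    have h1 := hσ_in j
    have h2 := hdisp j
    rw [hEq] at h1
    have : ((σ' j : Fin ℓ) : ℤ) = ((τw j : Fin ℓ) : ℤ) := by linarith
    exact_mod_cast this
  have hσP : ∀ b, P ((σ b : ℤ) - b) := by
    intro b
    by_cases hb : a ≤ (b : ℕ) ∧ (b : ℕ) < a + ℓ
    · have hb' : b = ⟨a + (((b : ℕ) - a : ℕ) : ℕ), by omega⟩ := Fin.ext (by simp; omega)
      have := hσ_in ⟨(b : ℕ) - a, by omega⟩
      rw [← hb'] at this
      have e : ((b : ℕ) : ℤ) = ((a + ((b : ℕ) - a) : ℕ) : ℤ) := by push_cast; omega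
      rw [show ((σ b : Fin m) : ℤ) - (b : ℤ) =
          ((σ' ⟨(b : ℕ) - a, by omega⟩ : Fin ℓ) : ℤ) - (((b : ℕ) - a : ℕ) : ℕ) + ((a' : ℤ) - a)
        by rw [← this, e]]
      exact hσ'P _
    · rw [hσ_out b hb]; exact hτP b
  have hlt := huniq σ hστ hσP
  set w : Fin m → ℤ := fun b => θ * ψ ((σ b : ℤ) - b) + α ((σ b : ℤ) - b) with hw
  set w' : Fin m → ℤ := fun b => θ * ψ ((τ b : ℤ) - b) + α ((τ b : ℤ) - b) with hw'
  have hsplit := sum_filter_add_sum_filter_not univ (fun x : Fin m => a ≤ (x : ℕ) ∧ (x : ℕ) < a + ℓ) w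
  have hsplit' := sum_filter_add_sum_filter_not univ (fun x : Fin m => a ≤ (x : ℕ) ∧ (x : ℕ) < a + ℓ) w'
  have hout : ∑ x ∈ univ.filter (fun x : Fin m => ¬ (a ≤ (x : ℕ) ∧ (x : ℕ) < a + ℓ)), w x =
      ∑ x ∈ univ.filter (fun x : Fin m => ¬ (a ≤ (x : ℕ) ∧ (x : ℕ) < a + ℓ)), w' x := by
    refine sum_congr rfl fun x hx => ?_
    simp only [mem_filter, mem_univ, true_and] at hx
    simp only [hw, hw', hσ_out x hx]
  have hin : ∑ x ∈ univ.filter (fun x : Fin m => a ≤ (x : ℕ) ∧ (x : ℕ) < a + ℓ), w x =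
      ∑ j : Fin ℓ, (θ * ψ (((σ' j : ℤ) - j) + ((a' : ℤ) - a)) + α (((σ' j : ℤ) - j) + ((a' : ℤ) - a))) := by
    rw [sum_finWindow_eq a ℓ h w]
    refine sum_congr rfl fun j _ => ?_
    simp only [hw]
    rw [← hσ_in j]
  have hin' : ∑ x ∈ univ.filter (fun x : Fin m => a ≤ (x : ℕ) ∧ (x : ℕ) < a + ℓ), w' x =
      ∑ j : Fin ℓ, (θ * ψ (((τw j : ℤ) - j) + ((a' : ℤ) - a)) + α (((τw j : ℤ) - j) + ((a' : ℤ) - a))) := by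
    rw [sum_finWindow_eq a ℓ h w']
    refine sum_congr rfl fun j _ => ?_
    simp only [hw']
    rw [hdisp j]
  have e1 : ∑ b, w b = ∑ b, (θ * ψ ((σ b : ℤ) - b) + α ((σ b : ℤ) - b)) := rfl
  have e2 : ∑ b, w' b = ∑ b, (θ * ψ ((τ b : ℤ) - b) + α ((τ b : ℤ) - b)) := rfl
  rw [← e1, ← e2, ← hsplit, ← hsplit', hout, hin, hin'] at hlt
  linarith

/-- **Members of a chain sharing a translated frame are bounded by the shifted instance's chain bound.**  Along a family
`τ` of pairwise distinct admissible unique maximisers at strictly increasing slopes, let `S` be a set of indices whose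
permutations map the window `[a, a + ℓ)` into `[a', a' + ℓ)` and agree outside `[a, a + ℓ)`.  Then `S.card ≤ Φ` for
every `Φ` bounding the chains of the SHIFTED instance `(ψ (· + t), α (· + t))`, `t = a' − a`, with admissible set
`P (· + t)`, at size `ℓ` (`toeplitz_opt_translatedWindow`). [folklore] -/
theorem toeplitz_translatedWindow_chain_le (ψ α : ℤ → ℤ) (P : ℤ → Prop) {N : ℕ} (θ' : Fin (N + 1) → ℤ)
    (τ : Fin (N + 1) → Equiv.Perm (Fin m)) (hθ : StrictMono θ') (hinj : Function.Injective τ)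
    (hτP : ∀ k b, P ((τ k b : ℤ) - b))
    (huniq : ∀ k (σ : Equiv.Perm (Fin m)), σ ≠ τ k → (∀ b, P ((σ b : ℤ) - b)) →
      ∑ b, (θ' k * ψ ((σ b : ℤ) - b) + α ((σ b : ℤ) - b)) <
        ∑ b, (θ' k * ψ ((τ k b : ℤ) - b) + α ((τ k b : ℤ) - b)))
    (a a' ℓ : ℕ) (h : a + ℓ ≤ m) (h' : a' + ℓ ≤ m) (S : Finset (Fin (N + 1)))
    (hinvS : ∀ k ∈ S, ∀ b : Fin m, a ≤ (b : ℕ) → (b : ℕ) < a + ℓ →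
      a' ≤ ((τ k b : Fin m) : ℕ) ∧ ((τ k b : Fin m) : ℕ) < a' + ℓ)
    (houtS : ∀ k ∈ S, ∀ k' ∈ S, ∀ x : Fin m, ¬ (a ≤ (x : ℕ) ∧ (x : ℕ) < a + ℓ) → τ k x = τ k' x)
    (Φ : ℕ)
    (hΦ : ∀ (N' : ℕ) (θ'' : Fin (N' + 1) → ℤ) (τ'' : Fin (N' + 1) → Equiv.Perm (Fin ℓ)),
      StrictMono θ'' → Function.Injective τ'' → (∀ k j, P (((τ'' k j : ℤ) - (j : ℤ)) + ((a' : ℤ) - a))) →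
      (∀ k (σ' : Equiv.Perm (Fin ℓ)), σ' ≠ τ'' k → (∀ j, P (((σ' j : ℤ) - (j : ℤ)) + ((a' : ℤ) - a))) →
        ∑ j, (θ'' k * ψ (((σ' j : ℤ) - (j : ℤ)) + ((a' : ℤ) - a)) + α (((σ' j : ℤ) - (j : ℤ)) + ((a' : ℤ) - a))) <
          ∑ j, (θ'' k * ψ (((τ'' k j : ℤ) - (j : ℤ)) + ((a' : ℤ) - a)) +
            α (((τ'' k j : ℤ) - (j : ℤ)) + ((a' : ℤ) - a)))) →
      N' + 1 ≤ Φ) :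
    S.card ≤ Φ := by
  rcases Nat.eq_zero_or_pos S.card with h0 | hpos
  · rw [h0]; exact Nat.zero_le _
  obtain ⟨N', hN'⟩ : ∃ N', S.card = N' + 1 := ⟨S.card - 1, by omega⟩
  have key : ∀ k, k ∈ S → ∃ τw : Equiv.Perm (Fin ℓ),
      (∀ (j : Fin ℓ) (b : Fin m), (b : ℕ) = a + j → ((τw j : Fin ℓ) : ℕ) + a' = ((τ k b : Fin m) : ℕ)) ∧
      (∀ j, P (((τw j : ℤ) - j) + ((a' : ℤ) - a))) ∧
      ∀ σ' : Equiv.Perm (Fin ℓ), σ' ≠ τw → (∀ j, P (((σ' j : ℤ) - j) + ((a' : ℤ) - a))) →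
        ∑ j, (θ' k * ψ (((σ' j : ℤ) - j) + ((a' : ℤ) - a)) + α (((σ' j : ℤ) - j) + ((a' : ℤ) - a))) <
          ∑ j, (θ' k * ψ (((τw j : ℤ) - j) + ((a' : ℤ) - a)) + α (((τw j : ℤ) - j) + ((a' : ℤ) - a))) :=
    fun k hk => toeplitz_opt_translatedWindow ψ α P (θ' k) (τ k) a a' ℓ h h' (hinvS k hk) (hτP k) (huniq k)
  choose τw hτw hPw hUw using key
  let ι := S.orderEmbOfFin hN'
  have hιmem : ∀ i, ι i ∈ S := fun i => S.orderEmbOfFin_mem hN' i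
  let θ'' : Fin (N' + 1) → ℤ := fun i => θ' (ι i)
  let τ'' : Fin (N' + 1) → Equiv.Perm (Fin ℓ) := fun i => τw (ι i) (hιmem i)
  have hθ'' : StrictMono θ'' := fun i i' hii => hθ (ι.strictMono hii)
  have hτ'' : Function.Injective τ'' := by
    intro i i' hii
    have hk : τ (ι i) = τ (ι i') := by
      apply Equiv.ext
      intro x
      by_cases hx : a ≤ (x : ℕ) ∧ (x : ℕ) < a + ℓ
      · apply Fin.ext
        have h1 := hτw (ι i) (hιmem i) ⟨(x : ℕ) - a, by omega⟩ x (by simp; omega)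
        have h2 := hτw (ι i') (hιmem i') ⟨(x : ℕ) - a, by omega⟩ x (by simp; omega)
        have h3 : τ'' i = τ'' i' := hii
        simp only [τ''] at h3
        rw [h3] at h1
        omega
      · exact houtS (ι i) (hιmem i) (ι i') (hιmem i') x hx
    exact ι.injective (hinj hk)
  rw [hN']
  exact hΦ N' θ'' τ'' hθ'' hτ'' (fun i j => hPw (ι i) (hιmem i) j)
    (fun i σ' hσ' hσ'P => hUw (ι i) (hιmem i) σ' hσ' hσ'P)

end TranslatedWindow

end Summit.ValiantsHypothesis.ValiantsHypothesis.Theorems.KPlusLogSqLaw
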